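import Mathlib
import HarnessLib
import Literature.MathematicalPhysics.QuantumLattice.FinDimSpectrumProofs
import Summits.HubbardSuperconductivity.HubbardSuperconductivity.Theorems.WeakCouplingBCSWcbcsBcsConstructionTrialStateSectors
import Summits.HubbardSuperconductivity.HubbardSuperconductivity.Theorems.WeakCouplingBCSWcbcsBcsConstructionLroSeedSelection

/-!
# Crux `WcbcsBcsConstruction`, line `lro-seed-kink-bridge`: the abstract sector-projected seed

Support file (`--supports stmt-HubbardSuperconductivity-2010`, registered sub-goal
`stub_lroSeedAbstract`) for the converse certificate `stub_lroSeedOfOrderFloor` of the line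
`lro-seed-kink-bridge` (order floor ⇒ number-definite LRO seeds). Pure finite-dimensional matrix
analysis: `N = diagonal deg` an `ℕ`-grading (particle number), `H` Hermitian with `[N, H] = 0`
(Hamiltonian), `X` with `[N, X] = -2X` (pair field), `O = X + Xᴴ` (order operator),
`P = XXᴴ + XᴴX` (the number-conserving part of `O²`), and a tracial ground state
`ω = K.groundStateFunctional` (`K` Hermitian; in the application `K = H - hO`).

* operator identities `O² = X² + Xᴴ² + P`, `2P - O² = (X - Xᴴ)ᴴ(X - Xᴴ)`, the variance bound
  `Re ω(O²) ≥ (Re ω(O))²`, hence `Re ω(P) ≥ ½ (Re ω(O))²`;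
* `[N, P] = [N, H - E₀] = 0`, so `M = P - κ(H - E₀)` is `deg`-block-diagonal, and for an
  `N`-eigenvector `v`: `⟨v, O²v⟩ = ⟨v, Pv⟩` (selection rule);
* `stub_lroSeedAbstract`: if `Re ω(H) - E₀(H) ≤ a`, `0 < r ≤ Re ω(O)` and `κa < r²/2` (`κ > 0`), the
  sector selection lemma (`stub_lroSeedSelection`) applied to `M` yields a UNIT vector `v` in ONE
  sector with `⟨v, O²v⟩ ≥ r²/2 - κa` and `κ (Re⟨v, Hv⟩ - E₀(H)) ≤ 2‖X‖²`.

No definitions; everything is proved.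
-/

set_option linter.dupNamespace false

namespace Summit.HubbardSuperconductivity.HubbardSuperconductivity.Theorems

open Literature.MathematicalPhysics.QuantumLattice Literature.Probability.LatticeModels Matrix Filter
open scoped Matrix.Norms.L2Operator ComplexOrder Topology

namespace WcbcsLroSeed

open WcbcsTrialState

variable {m : Type*} [Fintype m]

/-! ### Operator identities for `O = X + Xᴴ`, `P = XXᴴ + XᴴX` -/

/-- `O² = X² + Xᴴ² + P`. [folklore] -/
theorem order_sq_eq (X : Matrix m m ℂ) :
    (X + Xᴴ) * (X + Xᴴ) = X * X + Xᴴ * Xᴴ + (X * Xᴴ + Xᴴ * X) := by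
  noncomm_ring

/-- `2P - O² = (X - Xᴴ)ᴴ (X - Xᴴ)`. [folklore] -/
theorem two_pair_sub_order_sq (X : Matrix m m ℂ) :
    X * Xᴴ + Xᴴ * X + (X * Xᴴ + Xᴴ * X) - (X + Xᴴ) * (X + Xᴴ) = (X - Xᴴ)ᴴ * (X - Xᴴ) := by
  rw [conjTranspose_sub, conjTranspose_conjTranspose]
  noncomm_ring

/-- `P = XXᴴ + XᴴX` is Hermitian. [folklore] -/
theorem isHermitian_pair (X : Matrix m m ℂ) : (X * Xᴴ + Xᴴ * X).IsHermitian := by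
  have h1 : (X * Xᴴ).IsHermitian := isHermitian_mul_conjTranspose_self X
  have h2 : (Xᴴ * X).IsHermitian := isHermitian_conjTranspose_mul_self X
  exact h1.add h2

/-! ### Conservation: products of oppositely charged operators commute with `N` -/

/-- If `[N, Y] = cY` and `[N, Z] = -cZ` then `[N, YZ] = 0`. [folklore] -/
theorem commute_mul_of_commutator {N Y Z : Matrix m m ℂ} {c : ℝ}
    (hY : N * Y - Y * N = (c : ℂ) • Y) (hZ : N * Z - Z * N = ((-c : ℝ) : ℂ) • Z) :
    N * (Y * Z) = Y * Z * N := by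
  have h : N * (Y * Z) - Y * Z * N = (N * Y - Y * N) * Z + Y * (N * Z - Z * N) := by
    noncomm_ring
  rw [hY, hZ, smul_mul_assoc, mul_smul_comm, Complex.ofReal_neg, neg_smul, add_neg_cancel,
    sub_eq_zero] at h
  exact h

/-- `[N, P] = 0` for `[N, X] = -2X`, `N` Hermitian. [folklore] -/
theorem commute_pair {N X : Matrix m m ℂ} (hN : N.IsHermitian)
    (hX : N * X - X * N = ((-2 : ℝ) : ℂ) • X) :
    N * (X * Xᴴ + Xᴴ * X) = (X * Xᴴ + Xᴴ * X) * N := by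
  have hX' := commutator_conjTranspose_of_commutator hN hX
  have h1 : N * (X * Xᴴ) = X * Xᴴ * N :=
    commute_mul_of_commutator hX (by rw [neg_neg] at hX' ⊢; exact hX')
  have h2 : N * (Xᴴ * X) = Xᴴ * X * N := commute_mul_of_commutator hX' (by simpa using hX)
  rw [mul_add, add_mul, h1, h2]

/-! ### Diagonal gradings -/

variable [DecidableEq m]

/-- `‖P‖ ≤ 2‖X‖²`. [folklore] -/
theorem norm_pair_le (X : Matrix m m ℂ) : ‖X * Xᴴ + Xᴴ * X‖ ≤ 2 * ‖X‖ ^ 2 := by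
  have h1 : ‖X * Xᴴ‖ ≤ ‖X‖ * ‖X‖ := by
    calc ‖X * Xᴴ‖ ≤ ‖X‖ * ‖Xᴴ‖ := norm_mul_le _ _
      _ = ‖X‖ * ‖X‖ := by rw [l2_opNorm_conjTranspose]
  have h2 : ‖Xᴴ * X‖ ≤ ‖X‖ * ‖X‖ := by
    calc ‖Xᴴ * X‖ ≤ ‖Xᴴ‖ * ‖X‖ := norm_mul_le _ _
      _ = ‖X‖ * ‖X‖ := by rw [l2_opNorm_conjTranspose]
  calc ‖X * Xᴴ + Xᴴ * X‖ ≤ ‖X * Xᴴ‖ + ‖Xᴴ * X‖ := norm_add_le _ _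
    _ ≤ 2 * ‖X‖ ^ 2 := by nlinarith [h1, h2]


/-- A matrix commuting with a diagonal matrix is block-diagonal for its level sets. [folklore] -/
theorem apply_eq_zero_of_commute_diagonal {d : m → ℂ} {M : Matrix m m ℂ}
    (h : diagonal d * M = M * diagonal d) {s t : m} (hst : d s ≠ d t) : M s t = 0 := by
  have h1 := congrFun (congrFun h s) t
  rw [diagonal_mul, mul_diagonal] at h1
  have h2 : (d s - d t) * M s t = 0 := by rw [sub_mul, h1]; ring
  exact (mul_eq_zero.1 h2).resolve_left (sub_ne_zero.2 hst)

omit [Fintype m] in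
/-- The `ℕ`-grading `diagonal deg` is Hermitian. [folklore] -/
theorem isHermitian_diagonal_natCast (deg : m → ℕ) :
    (diagonal (fun s => ((deg s : ℕ) : ℂ))).IsHermitian := by
  rw [IsHermitian, diagonal_conjTranspose]
  congr 1
  funext s
  rw [Pi.star_apply, Complex.star_def, map_natCast]

/-- A vector supported in the sector `{deg = n₀}` is an eigenvector of `diagonal deg`. [folklore] -/
theorem diagonal_natCast_mulVec_of_support (deg : m → ℕ) {v : m → ℂ} {n₀ : ℕ}
    (hv : ∀ s, deg s ≠ n₀ → v s = 0) :
    diagonal (fun s => ((deg s : ℕ) : ℂ)) *ᵥ v = ((n₀ : ℝ) : ℂ) • v := by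
  funext s
  rw [mulVec_diagonal, Pi.smul_apply, smul_eq_mul, Complex.ofReal_natCast]
  by_cases h : deg s = n₀
  · rw [h]
  · rw [hv s h, mul_zero, mul_zero]

omit [DecidableEq m] in
/-- Selection rule `⟨v, O²v⟩ = ⟨v, Pv⟩` for an `N`-eigenvector `v`, `[N, X] = -2X`
(`X²v` and `Xᴴ²v` carry charge `a ∓ 4 ≠ a`). [folklore] -/
theorem order_sq_expect_eq_pair {N X : Matrix m m ℂ} (hN : N.IsHermitian)
    (hX : N * X - X * N = ((-2 : ℝ) : ℂ) • X) {v : m → ℂ} {a : ℝ} (hv : N *ᵥ v = (a : ℂ) • v) :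
    star v ⬝ᵥ (((X + Xᴴ) * (X + Xᴴ)) *ᵥ v) = star v ⬝ᵥ ((X * Xᴴ + Xᴴ * X) *ᵥ v) := by
  have hX' := commutator_conjTranspose_of_commutator hN hX
  have h1 : star v ⬝ᵥ ((X * X) *ᵥ v) = 0 := by
    rw [← mulVec_mulVec]
    exact star_dotProduct_eq_zero_of_eigen hN hv
      (eigen_mulVec_of_commutator hX (eigen_mulVec_of_commutator hX hv)) (by linarith)
  have h2 : star v ⬝ᵥ ((Xᴴ * Xᴴ) *ᵥ v) = 0 := by
    rw [← mulVec_mulVec]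
    exact star_dotProduct_eq_zero_of_eigen hN hv
      (eigen_mulVec_of_commutator hX' (eigen_mulVec_of_commutator hX' hv)) (by linarith)
  rw [order_sq_eq, add_mulVec, add_mulVec, dotProduct_add, dotProduct_add, h1, h2, zero_add, zero_add]

/-! ### The tracial ground state: variance and the pair bound -/

/-- Variance bound `(Re ω(O))² ≤ Re ω(O²)` for Hermitian `O` and the tracial ground state of a
Hermitian `K` (`ω((O - c)ᴴ(O - c)) ≥ 0`, `c = Re ω(O)`). [folklore] -/
theorem re_sq_le_re_order_sq [Nonempty m] {K O : Matrix m m ℂ} (hK : K.IsHermitian)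
    (hO : O.IsHermitian) :
    (K.groundStateFunctional O).re ^ 2 ≤ (K.groundStateFunctional (O * O)).re := by
  set c : ℝ := (K.groundStateFunctional O).re with hc
  have hC : ((c : ℂ) • (1 : Matrix m m ℂ))ᴴ = (c : ℂ) • (1 : Matrix m m ℂ) := by
    rw [conjTranspose_smul, conjTranspose_one, Complex.star_def, Complex.conj_ofReal]
  have hexp : (O - (c : ℂ) • (1 : Matrix m m ℂ))ᴴ * (O - (c : ℂ) • 1) =
      O * O - (c : ℂ) • O - (c : ℂ) • O + (c : ℂ) • ((c : ℂ) • (1 : Matrix m m ℂ)) := by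
    rw [conjTranspose_sub, hC, hO.eq]
    simp only [sub_mul, mul_sub, Matrix.mul_smul, Matrix.smul_mul, mul_one, one_mul]
    abel
  have hnn := groundStateFunctional_nonneg K (O - (c : ℂ) • (1 : Matrix m m ℂ))
  rw [hexp, map_add, map_sub, map_sub, map_smul, map_smul, map_smul, groundStateFunctional_one hK,
    smul_eq_mul, smul_eq_mul, smul_eq_mul, mul_one] at hnn
  obtain ⟨hre, -⟩ := Complex.nonneg_iff.mp hnn
  rw [Complex.add_re, Complex.sub_re, Complex.sub_re, Complex.re_ofReal_mul, Complex.re_ofReal_mul,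
    Complex.ofReal_re, ← hc] at hre
  nlinarith [hre]

/-- Pair bound `Re ω(P) ≥ ½ (Re ω(O))²` (`2P - O² ≥ 0` and the variance bound). [folklore] -/
theorem half_re_sq_le_re_pair [Nonempty m] {K : Matrix m m ℂ} (hK : K.IsHermitian)
    (X : Matrix m m ℂ) :
    (K.groundStateFunctional (X + Xᴴ)).re ^ 2 / 2 ≤
      (K.groundStateFunctional (X * Xᴴ + Xᴴ * X)).re := by
  have hO : (X + Xᴴ).IsHermitian := isHermitian_add_transpose_self X
  have h1 := re_sq_le_re_order_sq hK hO
  have hnn := groundStateFunctional_nonneg K (X - Xᴴ)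
  rw [← two_pair_sub_order_sq, map_sub, map_add] at hnn
  obtain ⟨hre, -⟩ := Complex.nonneg_iff.mp hnn
  rw [Complex.sub_re, Complex.add_re] at hre
  linarith

end WcbcsLroSeed

/-! ### The abstract seed (registered sub-goal) -/

open WcbcsLroSeed WcbcsTrialState in
/-- **Abstract sector-projected seed.** `N = diagonal deg` an `ℕ`-grading, `K`, `H` Hermitian,
`[N, H] = 0`, `[N, X] = -2X`, `ω = K.groundStateFunctional`. If `Re ω(H) - E₀(H) ≤ a`,
`0 < r ≤ Re ω(X + Xᴴ)`, `0 < κ` and `κa < r²/2`, then some UNIT vector `v` supported in ONE sector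
`{deg = n₀}` has `⟨v, (X + Xᴴ)² v⟩ ≥ r²/2 - κa` and `κ (Re⟨v, Hv⟩ - E₀(H)) ≤ 2‖X‖²`: apply the sector
selection lemma to the block-diagonal `M = (XXᴴ + XᴴX) - κ(H - E₀)`, whose state average is
`≥ r²/2 - κa > 0`, and read off both bounds from `0 ≤ H - E₀`, `XXᴴ + XᴴX ≤ 2‖X‖²` and the selection
rule `⟨v, (X + Xᴴ)²v⟩ = ⟨v, (XXᴴ + XᴴX)v⟩`. [cite: KomaTasaki1994, Theorem 2.2] -/
theorem stub_lroSeedAbstract :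
    ∀ {m : Type} [Fintype m] [DecidableEq m] [Nonempty m] (deg : m → ℕ) {N K H X : Matrix m m ℂ},
      N = diagonal (fun s => ((deg s : ℕ) : ℂ)) → K.IsHermitian → H.IsHermitian →
      N * H = H * N → N * X - X * N = ((-2 : ℝ) : ℂ) • X →
      ∀ {a r κ : ℝ}, (K.groundStateFunctional H).re - H.groundEnergy ≤ a → 0 < r →
        r ≤ (K.groundStateFunctional (X + Xᴴ)).re → 0 < κ → κ * a < r ^ 2 / 2 →
        ∃ (n₀ : ℕ) (v : m → ℂ), star v ⬝ᵥ v = 1 ∧ (∀ s, deg s ≠ n₀ → v s = 0) ∧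
          r ^ 2 / 2 - κ * a ≤ (star v ⬝ᵥ (((X + Xᴴ) * (X + Xᴴ)) *ᵥ v)).re ∧
          κ * ((star v ⬝ᵥ (H *ᵥ v)).re - H.groundEnergy) ≤ 2 * ‖X‖ ^ 2 := by
  intro m _ _ _ deg N K H X hNdef hK hH hNH hNX a r κ ha hr hrO hκ hκa
  have hN : N.IsHermitian := by
    rw [hNdef]
    exact isHermitian_diagonal_natCast deg
  -- the operators
  set E₀ : ℝ := H.groundEnergy with hE₀
  set P : Matrix m m ℂ := X * Xᴴ + Xᴴ * X with hP
  set A : Matrix m m ℂ := H - (E₀ : ℂ) • (1 : Matrix m m ℂ) with hA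
  set M : Matrix m m ℂ := P - (κ : ℂ) • A with hM
  have hPh : P.IsHermitian := isHermitian_pair X
  have hAh : A.IsHermitian := by
    refine hH.sub (IsHermitian.smul isHermitian_one ?_)
    rw [isSelfAdjoint_iff, Complex.star_def, Complex.conj_ofReal]
  have hMh : M.IsHermitian := by
    refine hPh.sub (IsHermitian.smul hAh ?_)
    rw [isSelfAdjoint_iff, Complex.star_def, Complex.conj_ofReal]
  -- `M` commutes with `N`, hence is block-diagonal
  have hNP : N * P = P * N := commute_pair hN hNX
  have hNA : N * A = A * N := by
    rw [hA, mul_sub, sub_mul, hNH, mul_smul_comm, smul_mul_assoc, mul_one, one_mul]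
  have hNM : N * M = M * N := by
    rw [hM, mul_sub, sub_mul, hNP, mul_smul_comm, smul_mul_assoc, hNA]
  have hblock : ∀ s t, deg s ≠ deg t → M s t = 0 := by
    intro s t hst
    rw [hNdef] at hNM
    exact apply_eq_zero_of_commute_diagonal hNM (by exact_mod_cast hst)
  -- the state average of `M`
  have hωA : (K.groundStateFunctional A).re = (K.groundStateFunctional H).re - E₀ := by
    rw [hA, map_sub, map_smul, groundStateFunctional_one hK, smul_eq_mul, mul_one, Complex.sub_re,
      Complex.ofReal_re]
  have hωP : r ^ 2 / 2 ≤ (K.groundStateFunctional P).re := by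
    have h1 := half_re_sq_le_re_pair hK X
    have h2 : r ^ 2 ≤ (K.groundStateFunctional (X + Xᴴ)).re ^ 2 := by
      have := hr.le
      nlinarith [hrO]
    rw [← hP] at h1
    linarith
  have hωM : (K.groundStateFunctional M).re =
      (K.groundStateFunctional P).re - κ * (K.groundStateFunctional A).re := by
    rw [hM, map_sub, map_smul, smul_eq_mul, Complex.sub_re, Complex.re_ofReal_mul]
  have hωM_ge : r ^ 2 / 2 - κ * a ≤ (K.groundStateFunctional M).re := by
    rw [hωM, hωA]
    nlinarith [hωP, ha, hκ.le]
  have hωM_pos : 0 < (K.groundStateFunctional M).re := by linarith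
  -- sector selection
  obtain ⟨n₀, v, hv1, hsupp, hsel⟩ := stub_lroSeedSelection deg hK hMh hblock hωM_pos
  refine ⟨n₀, v, hv1, hsupp, ?_, ?_⟩
  · -- order: `⟨v, O²v⟩ = ⟨v, Pv⟩ = ⟨v, Mv⟩ + κ⟨v, Av⟩ ≥ ⟨v, Mv⟩`
    have hNv : N *ᵥ v = ((n₀ : ℝ) : ℂ) • v := by
      rw [hNdef]
      exact diagonal_natCast_mulVec_of_support deg hsupp
    have hsel_rule := order_sq_expect_eq_pair hN hNX hNv
    rw [hsel_rule, ← hP]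
    have hvA : 0 ≤ (star v ⬝ᵥ (A *ᵥ v)).re := by
      have h := groundEnergy_le_rayleigh_holds hH v hv1
      rw [hA, sub_mulVec, smul_mulVec, one_mulVec, dotProduct_sub, dotProduct_smul, hv1, smul_eq_mul,
        mul_one, Complex.sub_re, Complex.ofReal_re]
      linarith
    have hvM : (star v ⬝ᵥ (M *ᵥ v)).re =
        (star v ⬝ᵥ (P *ᵥ v)).re - κ * (star v ⬝ᵥ (A *ᵥ v)).re := by
      rw [hM, sub_mulVec, smul_mulVec, dotProduct_sub, dotProduct_smul, smul_eq_mul, Complex.sub_re,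
        Complex.re_ofReal_mul]
    nlinarith [hsel, hωM_ge, hvA, hκ.le]
  · -- energy: `κ⟨v, Av⟩ = ⟨v, Pv⟩ - ⟨v, Mv⟩ ≤ ‖P‖ ≤ 2‖X‖²`
    have hvA : (star v ⬝ᵥ (A *ᵥ v)).re = (star v ⬝ᵥ (H *ᵥ v)).re - E₀ := by
      rw [hA, sub_mulVec, smul_mulVec, one_mulVec, dotProduct_sub, dotProduct_smul, hv1, smul_eq_mul,
        mul_one, Complex.sub_re, Complex.ofReal_re]
    have hvM : (star v ⬝ᵥ (M *ᵥ v)).re =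
        (star v ⬝ᵥ (P *ᵥ v)).re - κ * (star v ⬝ᵥ (A *ᵥ v)).re := by
      rw [hM, sub_mulVec, smul_mulVec, dotProduct_sub, dotProduct_smul, smul_eq_mul, Complex.sub_re,
        Complex.re_ofReal_mul]
    have hvP : (star v ⬝ᵥ (P *ᵥ v)).re ≤ 2 * ‖X‖ ^ 2 := by
      have h1 := re_star_dotProduct_mulVec_le P v
      rw [eucNorm_eq_one hv1, one_pow, mul_one] at h1
      exact h1.trans (norm_pair_le X)
    rw [← hvA]
    nlinarith [hsel, hωM_ge, hvM, hvP, hκa, hκ.le]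

end Summit.HubbardSuperconductivity.HubbardSuperconductivity.Theorems
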